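import Mathlib
import Summits.Ventures.HodgeRepro.Tier4.Common.AdelicDefs
import Summits.Ventures.HodgeRepro.Tier4.Common.MixedPlaneKType

/-!
# Tier4/Line4/TransportSelfAdjoint — the correct transport of the second torus under a row similitude: for
`g * B * gᵀ = lam • B′` the projectors `g' * P′ * g` are `B`-self-adjoint whenever `P′` is `B′`-self-adjoint (the
general lemma behind the kernel witness of `Line4/TransportProbe`)

Blind re-derivation cell `pub-hodge-repro`, Tier 4 «prove the step» (README §9–§10), seat t4-L4-p2 (gen 2; LINE L4).
Tree path `lean/Summits/Ventures/HodgeRepro/Tier4/Line4/TransportSelfAdjoint.lean`.  Imports `Common/AdelicDefs`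
(`PlaneData`) and `Common/MixedPlaneKType` (`withTransportedTorus`).

THE LEMMA.  Row convention (`v ↦ v g`): from `g * B * gᵀ = lam • B′` and `g' * g = 1`, `g * g' = 1` one gets
`B = lam • (g' * B′ * g'ᵀ)`, hence for a `B′`-self-adjoint `P′` (`P′ * B′ = B′ * P′ᵀ`): `(g' * P′ * g) * B = lam •
(g' * P′ * B′ * g'ᵀ) = lam • (g' * B′ * P′ᵀ * g'ᵀ) = B * (g' * P′ * g)ᵀ`.  So the projectors of the torus of `U′`
transported INTO `U(B)` are `g' * P′ * g` — `withTransportedTorus g' g` in the vocabulary of `MixedPlaneKType` — not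
`g * P′ * g'` (`withTransportedTorus g g'`, which `TransportProbe` shows is not `B`-self-adjoint in general).  The
corollary `withTransportedTorus_inv_Q_selfAdjoint` states it on `withTransportedTorus g' g` for the row planes, whose
standard projectors are those of `U` itself.  Nothing here is about the wall's truth; it is the algebra a v0.16
re-typing of `seesawPlane` consumes.  HC_CM is NOT proved by anyone in this repository.
-/

set_option autoImplicit false

noncomputable section

namespace Summit.Ventures.HodgeRepro.Tier4.Line4

open Matrix Summit.Ventures.HodgeRepro.Tier4.Common

section Transport

variable {k : Type} [Field k]

/-- `B = lam • (g' * B′ * g'ᵀ)` from the row similitude `g * B * gᵀ = lam • B′` and `g' = g⁻¹`. -/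
theorem B_eq_of_similitude (B B' g g' : Matrix (Fin 4) (Fin 4) k) (hg'g : g' * g = 1)
    (lam : k) (hiso : g * B * gᵀ = lam • B') : B = lam • (g' * B' * g'ᵀ) := by
  have hT : gᵀ * g'ᵀ = 1 := by rw [← transpose_mul, hg'g, transpose_one]
  calc B = (g' * g) * B * (gᵀ * g'ᵀ) := by rw [hg'g, hT, Matrix.one_mul, Matrix.mul_one]
    _ = g' * (g * B * gᵀ) * g'ᵀ := by simp only [Matrix.mul_assoc]
    _ = g' * (lam • B') * g'ᵀ := by rw [hiso]
    _ = lam • (g' * B' * g'ᵀ) := by simp only [Matrix.mul_smul, Matrix.smul_mul]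

/-- **The transported projector `g' * P′ * g` is `B`-self-adjoint** when `P′` is `B′`-self-adjoint and
`g * B * gᵀ = lam • B′`. -/
theorem transported_selfAdjoint (B B' P' g g' : Matrix (Fin 4) (Fin 4) k) (hgg' : g * g' = 1)
    (hg'g : g' * g = 1) (lam : k) (hiso : g * B * gᵀ = lam • B') (hP : P' * B' = B' * P'ᵀ) :
    (g' * P' * g) * B = B * (g' * P' * g)ᵀ := by
  have hB := B_eq_of_similitude B B' g g' hg'g lam hiso
  have hT2 : g'ᵀ * gᵀ = 1 := by rw [← transpose_mul, hgg', transpose_one]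
  rw [hB]
  simp only [transpose_mul, Matrix.mul_smul, Matrix.smul_mul, Matrix.mul_assoc]
  congr 1
  rw [← Matrix.mul_assoc g g', hgg', Matrix.one_mul, ← Matrix.mul_assoc g'ᵀ gᵀ, hT2, Matrix.one_mul,
    ← Matrix.mul_assoc P' B', hP, Matrix.mul_assoc]

/-- **On the row planes** (`withTransportedTorus` transports the plane's OWN projectors `P i`): with `g' * g = 1`,
`g * g' = 1`, `g'` commuting with `Ω` and the row similitude `g * W.B * gᵀ = lam • B′` for a `B′` with
`W.P i * B′ = B′ * (W.P i)ᵀ`, the second projectors of `W.withTransportedTorus g' g` are `W.B`-self-adjoint. -/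
theorem withTransportedTorus_inv_Q_selfAdjoint (W : PlaneData k) (g g' : Matrix (Fin 4) (Fin 4) k)
    (hgg' : g * g' = 1) (hg'g : g' * g = 1) (hg'Ω : g' * W.Ω = W.Ω * g') (B' : Matrix (Fin 4) (Fin 4) k) (lam : k)
    (hiso : g * W.B * gᵀ = lam • B') (i : Fin 2) (hP : W.P i * B' = B' * (W.P i)ᵀ) :
    (W.withTransportedTorus g' g hg'g hgg' hg'Ω).Q i * W.B =
      W.B * ((W.withTransportedTorus g' g hg'g hgg' hg'Ω).Q i)ᵀ := by
  rw [withTransportedTorus_Q]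
  exact transported_selfAdjoint W.B B' (W.P i) g g' hgg' hg'g lam hiso hP

end Transport

end Summit.Ventures.HodgeRepro.Tier4.Line4

end
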